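import Summits.ABC.StewartYu.PadicG3TwoParTwo
import HarnessLib

/-!
# Cell abc-stewartyu, WP-L.P(2) (crux r4 `PadicCoreTwoRat`, stmt-ABC-20504), record: `RecordTwo` for the parameter record's END data
# at an ARBITRARY coefficient logarithm `W' ≥ 1` (the exit-C bracket uses only `W' ≥ 1`)

`Summits/ABC/StewartYu/PadicG3TwoRecordW.lean` — cell `abc-stewartyu` (HOME `run/shared/lean/pub/abc-stewartyu/`), route
`YuMatveevShapeRat`, seat p3 (g10, WP-L.P(2) lead).  Theorems only.  WHY: the 𝔑-threaded record is instantiated at the PADDED letter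
`W̃ = W + c_W(d)` (`c_W(d) = (2d+5)(d+1)` absorbs the `2·log((d+1)!)` of the saturated coefficient bound `|b̃ₖ| ≤ (d+1)(d+1)!·N·e^W` into
the directional slot `X ≥ 64(n+1)W_L/G`), while the crux's END clause needs `RecordTwo C (d+1) V Vmax W …` at the CRUX `W`.  lp-1's exit-C
proof (`PadicG3ExitC.bracket_le`, `PadicG3ClauseC.clauseC_final`/`exitC_two`) uses the record's `W` only through `1 ≤ P.W`, so the same
proofs give `RecordTwo` at any `W' ≥ 1` for the END data `(P.D₀, P.S₀N, P.Xfin, P.D)`: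
* `bracket_le_W`, `clauseC_final_W`, `exitC_two_W` — verbatim copies with `W'` in place of `P.W`;
* `recordTwo_of_numeric_W`, `recordTwo_of_convention_W`;
* **`ParTwo.recordTwo_parTwo_W`** — `RecordTwo C (d+1) V Vmax W' (parTwo V Vmax W).D₀ … .D` for every `1 ≤ W'` (so the record at `W̃`
  serves the crux at `W`).

WHAT THIS IS NOT: a new record; no crux moves.

References: Yu. V. Nesterenko, LNM 1819 (2003), §5.2 (5.13)–(5.22), Lemmas 5.3–5.4.
-/

noncomputable section

open Finset Real Nat

namespace Summit.ABC.StewartYu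

namespace PadicG3Par

open Summit.ABC.StewartYu.GenThreeFrameSpecTwo (RecordTwo)

variable {n : ℕ} (P : PadicG3Par n)

/-- **The logarithmic bracket at an arbitrary `W' ≥ 1`** (copy of `bracket_le`). [folklore] -/
theorem bracket_le_W {r : ℕ} {Q E : ℝ} (hQ0 : 0 < Q) (hE : 0 ≤ E) {W' : ℝ} (hW' : 1 ≤ W')
    (hQ : Q * (14 * n + 3) ≤ (256 : ℝ) ^ (n - r) * P.Ω) :
    W' + Real.log 3 + Real.log n + Real.log P.Amax + Real.log Q + E + Real.log (2 * Q) ≤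
      (14 * n + 3) * (W' + E + Real.log (2 * P.Amax)) := by
  have hW := hW'
  have hA1 := P.hAmax1
  have hΩ := P.Ω_pos
  have hn1 : (1 : ℝ) ≤ n := by exact_mod_cast P.hn
  have hlogA : 0 ≤ Real.log P.Amax := Real.log_nonneg hA1
  have hlog2 : Real.log 2 < 0.6931471808 := Real.log_two_lt_d9
  have hlog2' : 0 < Real.log 2 := by have := Real.log_two_gt_d9; linarith
  have hlog3 : Real.log 3 ≤ 2 := by
    have := Real.log_le_sub_one_of_pos (show (0 : ℝ) < 3 by norm_num); linarith
  have hlogn : Real.log n ≤ n := by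
    have := Real.log_le_sub_one_of_pos (show (0 : ℝ) < n by linarith); linarith
  -- `log Ω ≤ n log Amax`
  have hlogΩ : Real.log P.Ω ≤ n * Real.log P.Amax := by
    have h := Real.log_le_log hΩ P.Ω_le_pow
    rwa [Real.log_pow] at h
  -- `Q ≤ 256^{n-r} Ω` and `log Q ≤ 8 (n-r) log 2 + n log Amax ≤ 5.6 n + n log Amax`
  have hQ1 : Q ≤ (256 : ℝ) ^ (n - r) * P.Ω := by nlinarith
  have hlogQ : Real.log Q ≤ 5.6 * n + n * Real.log P.Amax := by
    have h := Real.log_le_log hQ0 hQ1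
    rw [Real.log_mul (by positivity) hΩ.ne', Real.log_pow] at h
    have h256 : Real.log 256 = 8 * Real.log 2 := by
      rw [show (256 : ℝ) = 2 ^ 8 by norm_num, Real.log_pow]; norm_num
    rw [h256] at h
    have hnr : ((n - r : ℕ) : ℝ) ≤ n := by exact_mod_cast Nat.sub_le n r
    have : ((n - r : ℕ) : ℝ) * (8 * Real.log 2) ≤ n * 5.6 := by nlinarith
    linarith
  have hlog2Q : Real.log (2 * Q) ≤ 0.7 + 5.6 * n + n * Real.log P.Amax := by
    rw [Real.log_mul (by norm_num) hQ0.ne']; linarith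
  have hlog2A : Real.log (2 * P.Amax) = Real.log 2 + Real.log P.Amax := by
    rw [Real.log_mul (by norm_num) (by linarith)]
  rw [hlog2A]
  have hn0 : (0 : ℝ) ≤ n := by linarith
  -- the products with `n`
  have t1 : (n : ℝ) ≤ (n : ℝ) * W' := by nlinarith
  have t2 : 0 ≤ (n : ℝ) * E := mul_nonneg hn0 hE
  have t3 : 0 ≤ (n : ℝ) * Real.log P.Amax := mul_nonneg hn0 hlogA
  have t4 : 0 ≤ (n : ℝ) * Real.log 2 := mul_nonneg hn0 hlog2'.le
  have e : (14 * (n : ℝ) + 3) * (W' + E + (Real.log 2 + Real.log P.Amax)) =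
      14 * ((n : ℝ) * W') + 3 * W' + 14 * ((n : ℝ) * E) + 3 * E + 14 * ((n : ℝ) * Real.log 2) +
        3 * Real.log 2 + 14 * ((n : ℝ) * Real.log P.Amax) + 3 * Real.log P.Amax := by ring
  rw [e]
  linarith


/-- The final step of clause (C) at an arbitrary `W' ≥ 1` (copy of `clauseC_final`). [cite: Nesterenko2003, §5.2 (5.22)] -/
theorem clauseC_final_W {C : ℕ → ℝ} (hC0 : ∀ r, 0 ≤ C r) (hCg : ∀ r, r < n → (256 : ℝ) ^ (n - r) * C r ≤ C n)
    {r : ℕ} (hr : r < n) {W' : ℝ} (hW' : 1 ≤ W') {Q E : ℝ} (hQ0 : 0 < Q) (hE : 0 ≤ E)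
    (hQ : Q * (14 * n + 3) ≤ (256 : ℝ) ^ (n - r) * P.Ω) :
    C r * Q * (W' + Real.log 3 + Real.log n + Real.log P.Amax + Real.log Q + E + Real.log (2 * Q)) ≤
      C n * (∏ j, P.A j) * (W' + E + Real.log (2 * P.Amax)) := by
  have hB := P.bracket_le_W hQ0 hE hW' hQ
  have hΩ := P.Ω_pos
  have hCr := hC0 r
  have hCn := hC0 n
  have hpos : 0 < W' + E + Real.log (2 * P.Amax) := by
    have h1 := hW'
    have h2 : 0 ≤ Real.log (2 * P.Amax) := Real.log_nonneg (by linarith [P.hAmax1])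
    linarith
  change C r * Q * _ ≤ C n * P.Ω * _
  by_cases hneg : W' + Real.log 3 + Real.log n + Real.log P.Amax + Real.log Q + E + Real.log (2 * Q) ≤ 0
  · calc C r * Q * (W' + Real.log 3 + Real.log n + Real.log P.Amax + Real.log Q + E + Real.log (2 * Q))
        ≤ 0 := mul_nonpos_of_nonneg_of_nonpos (mul_nonneg hCr hQ0.le) hneg
      _ ≤ C n * P.Ω * (W' + E + Real.log (2 * P.Amax)) := by positivity
  · push Not at hneg
    calc C r * Q * (W' + Real.log 3 + Real.log n + Real.log P.Amax + Real.log Q + E + Real.log (2 * Q))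
        ≤ C r * Q * ((14 * n + 3) * (W' + E + Real.log (2 * P.Amax))) :=
          mul_le_mul_of_nonneg_left hB (mul_nonneg hCr hQ0.le)
      _ = C r * (Q * (14 * n + 3)) * (W' + E + Real.log (2 * P.Amax)) := by ring
      _ ≤ C r * ((256 : ℝ) ^ (n - r) * P.Ω) * (W' + E + Real.log (2 * P.Amax)) := by gcongr
      _ = ((256 : ℝ) ^ (n - r) * C r) * P.Ω * (W' + E + Real.log (2 * P.Amax)) := by ring
      _ ≤ C n * P.Ω * (W' + E + Real.log (2 * P.Amax)) := by gcongr; exact hCg r hr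


/-- **Clause (C) for the `p = 2` record at an arbitrary `W' ≥ 1`** (copy of `exitC_two`). [cite: Nesterenko2003, §5.2 (5.22)] -/
theorem exitC_two_W (hKNq : P.K ≤ P.Nq) (hNqK : P.Nq ≤ 2 ^ n * P.K) (hθ : (1 / 2 : ℝ) ≤ P.θ₀)
    (hAmax : P.Amax ≤ 2 ^ n * P.Ω) (hA1 : ∀ j, 1 ≤ P.A j) {W' : ℝ} (hW' : 1 ≤ W')
    {C : ℕ → ℝ} (hC0 : ∀ r, 0 ≤ C r) (hCg : ∀ r, r < n → (256 : ℝ) ^ (n - r) * C r ≤ C n)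
    (hnum1 : ∀ r : ℕ, 0 < r → r < n →
      ((r ! : ℕ) : ℝ) ^ 2 * (n : ℝ) ^ r * (((n + 1)! : ℕ) : ℝ) * 2 ^ r * (((r - 1)! : ℕ) : ℝ) *
          (((2 : ℝ) ^ (n + 23))⁻¹ + 2 ^ n / (24 * Cb ^ n)) ^ r * (264 * Cb ^ n + 2 ^ (2 * n + 26)) *
          (14 * n + 3) ≤
        (256 : ℝ) ^ (n - r) * (16 * ((n : ℝ) + 1) / ((n : ℝ) + 2) ^ 4) ^ (r - 1) * 2 ^ (n + 22) *
          (((n - r + 1)! : ℕ) : ℝ))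
    (hnum0 : ∀ r : ℕ, 0 < r → r < n →
      ((r ! : ℕ) : ℝ) ^ 3 * (n : ℝ) ^ r * (((n + 1)! : ℕ) : ℝ) * 2 ^ (r - 1) *
          (((2 : ℝ) ^ (n + 23))⁻¹ + 2 ^ n / (24 * Cb ^ n)) ^ r * (264 * Cb ^ n + 2 ^ (2 * n + 26)) *
          (14 * n + 3) ≤
        (256 : ℝ) ^ (n - r) * (16 * ((n : ℝ) + 1) / ((n : ℝ) + 2) ^ 4) ^ r * 2 ^ (n + 22) *
          (((n - r)! : ℕ) : ℝ)) :
    ∀ r d₀ : ℕ, 0 < r → r < n → d₀ ≤ 1 →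
      C r * (((r.factorial : ℝ)) ^ 2 * (n : ℝ) ^ r *
              ((((n + 1).factorial * 2 ^ n * P.D₀ : ℕ) : ℝ) *
                ((P.Nq : ℝ) * P.L / 2 ^ P.Sdepth + P.Amax) ^ r /
                ((Nat.choose (P.S₀N + (r - d₀)) (r - d₀) * (2 * P.Xfin + 1) *
                  ((d₀ + (n - r)).factorial * 2 ^ (n - r) * P.D₀ ^ d₀) : ℕ) : ℝ))) *
          (W' + Real.log 3 + Real.log n + Real.log P.Amax +
            Real.log (((r.factorial : ℝ)) ^ 2 * (n : ℝ) ^ r *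
              ((((n + 1).factorial * 2 ^ n * P.D₀ : ℕ) : ℝ) *
                ((P.Nq : ℝ) * P.L / 2 ^ P.Sdepth + P.Amax) ^ r /
                ((Nat.choose (P.S₀N + (r - d₀)) (r - d₀) * (2 * P.Xfin + 1) *
                  ((d₀ + (n - r)).factorial * 2 ^ (n - r) * P.D₀ ^ d₀) : ℕ) : ℝ))) +
            Real.log (2 * (((r.factorial : ℝ)) ^ 2 * (n : ℝ) ^ r *
              ((((n + 1).factorial * 2 ^ n * P.D₀ : ℕ) : ℝ) *
                ((P.Nq : ℝ) * P.L / 2 ^ P.Sdepth + P.Amax) ^ r /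
                ((Nat.choose (P.S₀N + (r - d₀)) (r - d₀) * (2 * P.Xfin + 1) *
                  ((d₀ + (n - r)).factorial * 2 ^ (n - r) * P.D₀ ^ d₀) : ℕ) : ℝ))))) ≤
        C n * (∏ j, P.A j) * (W' + Real.log (2 * P.Amax)) := by
  intro r d₀ hr0 hrn hd₀
  have hQ0 := P.Q_pos r d₀
  set Q := ((r ! : ℕ) : ℝ) ^ 2 * (n : ℝ) ^ r *
        (((((n + 1)! * 2 ^ n * P.D₀ : ℕ) : ℝ) * ((P.Nq : ℝ) * P.L / 2 ^ P.Sdepth + P.Amax) ^ r /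
          ((Nat.choose (P.S₀N + (r - d₀)) (r - d₀) * (2 * P.Xfin + 1) *
            ((d₀ + (n - r))! * 2 ^ (n - r) * P.D₀ ^ d₀) : ℕ) : ℝ))) with hQdef
  have hQ : Q * (14 * n + 3) ≤ (256 : ℝ) ^ (n - r) * P.Ω := by
    rcases Nat.le_one_iff_eq_zero_or_eq_one.mp hd₀ with rfl | rfl
    · exact P.Q_mul_le_zero hKNq hNqK hθ hAmax hA1 hr0 hrn (hnum0 r hr0 hrn)
    · exact P.Q_mul_le_one hKNq hNqK hθ hAmax hA1 hr0 hrn (hnum1 r hr0 hrn)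
  have h := P.clauseC_final_W hC0 hCg hrn hW' hQ0 le_rfl hQ
  simpa only [add_zero] using h


/-- **`RecordTwo` by name for `PadicG3Par` at an arbitrary `W' ≥ 1`** (modulo the constant comparisons).
[cite: Nesterenko2003, §5.2 (5.13)–(5.22), Lemmas 5.3–5.4] -/
theorem recordTwo_of_numeric_W (hKNq : P.K ≤ P.Nq) (hNqK : P.Nq ≤ 2 ^ n * P.K) (hθ : (1 / 2 : ℝ) ≤ P.θ₀)
    (hAmax : P.Amax ≤ 2 ^ n * P.Ω) (hA1 : ∀ j, 1 ≤ P.A j) {W' : ℝ} (hW' : 1 ≤ W')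
    {C : ℕ → ℝ} (hC0 : ∀ r, 0 ≤ C r) (hCg : ∀ r, r < n → (256 : ℝ) ^ (n - r) * C r ≤ C n)
    (hnum1 : ∀ r : ℕ, 0 < r → r < n →
      ((r ! : ℕ) : ℝ) ^ 2 * (n : ℝ) ^ r * (((n + 1)! : ℕ) : ℝ) * 2 ^ r * (((r - 1)! : ℕ) : ℝ) *
          (((2 : ℝ) ^ (n + 23))⁻¹ + 2 ^ n / (24 * Cb ^ n)) ^ r * (264 * Cb ^ n + 2 ^ (2 * n + 26)) *
          (14 * n + 3) ≤
        (256 : ℝ) ^ (n - r) * (16 * ((n : ℝ) + 1) / ((n : ℝ) + 2) ^ 4) ^ (r - 1) * 2 ^ (n + 22) *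
          (((n - r + 1)! : ℕ) : ℝ))
    (hnum0 : ∀ r : ℕ, 0 < r → r < n →
      ((r ! : ℕ) : ℝ) ^ 3 * (n : ℝ) ^ r * (((n + 1)! : ℕ) : ℝ) * 2 ^ (r - 1) *
          (((2 : ℝ) ^ (n + 23))⁻¹ + 2 ^ n / (24 * Cb ^ n)) ^ r * (264 * Cb ^ n + 2 ^ (2 * n + 26)) *
          (14 * n + 3) ≤
        (256 : ℝ) ^ (n - r) * (16 * ((n : ℝ) + 1) / ((n : ℝ) + 2) ^ 4) ^ r * 2 ^ (n + 22) *
          (((n - r)! : ℕ) : ℝ)) :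
    RecordTwo C n P.A P.Amax W' P.D₀ P.S₀N P.Xfin P.D :=
  RecordExits.recordTwo_of_ineqs hC0 P.hn hA1 P.hAmax1 (by linarith)
    (by unfold D₀; omega) P.one_le_D P.D_le_Dmax P.D_mul_A_le
    P.exitA (P.exitB hKNq) (P.exitC_two_W hKNq hNqK hθ hAmax hA1 hW' hC0 hCg hnum1 hnum0)

/-- **`RecordTwo` BY NAME for `PadicG3Par` at an arbitrary `W' ≥ 1`** from the instantiation convention and an admissible constant.
[cite: Nesterenko2003, §5.2 (5.13)–(5.22), Lemmas 5.3–5.4] -/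
theorem recordTwo_of_convention_W (hKNq : P.K ≤ P.Nq) (hNqK : P.Nq ≤ 2 ^ n * P.K)
    (hθ : (1 / 2 : ℝ) ≤ P.θ₀) (hAmax : P.Amax ≤ 2 ^ n * P.Ω) (hA1 : ∀ j, 1 ≤ P.A j) {W' : ℝ} (hW' : 1 ≤ W')
    {C : ℕ → ℝ} (hC0 : ∀ r, 0 ≤ C r) (hCg : ∀ r, r < n → (256 : ℝ) ^ (n - r) * C r ≤ C n) :
    RecordTwo C n P.A P.Amax W' P.D₀ P.S₀N P.Xfin P.D :=
  P.recordTwo_of_numeric_W hKNq hNqK hθ hAmax hA1 hW' hC0 hCg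
    (fun r h0 h => hnum1_holds n r h0 h)
    (fun r h0 h => hnum0_holds n r h0 h)

end PadicG3Par

namespace ParTwo

variable {d : ℕ} (V : Fin (d + 1) → ℝ) (Vmax W : ℝ) (hV1 : ∀ j, 1 ≤ V j) (hVmax : ∀ j, V j ≤ Vmax) (hW : 1 ≤ W)

/-- **`RecordTwo` FOR THE DATUM'S RECORD AT THE LETTER `W`, READ AT ANY `W' ≥ 1`** (and the datum's own `Vmax`), at the dyadic END data
`(P.D₀, P.S₀N, P.Xfin, P.D)` of `P = parTwo V Vmax W` (`d ≥ 1`): the record built at a padded `W` serves the crux at its own `W'`.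
[cite: Nesterenko2003, §5.2 (5.13)–(5.22), Lemmas 5.3–5.4] -/
theorem recordTwo_parTwo_W (hd : 1 ≤ d) {W' : ℝ} (hW' : 1 ≤ W') {C : ℕ → ℝ} (hC0 : ∀ r, 0 ≤ C r)
    (hCg : ∀ r, r < d + 1 → (256 : ℝ) ^ (d + 1 - r) * C r ≤ C (d + 1)) :
    GenThreeFrameSpecTwo.RecordTwo C (d + 1) V Vmax W' (parTwo V Vmax W hV1 hVmax hW).D₀
      (parTwo V Vmax W hV1 hVmax hW).S₀N (parTwo V Vmax W hV1 hVmax hW).Xfin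
      (parTwo V Vmax W hV1 hVmax hW).D := by
  have h := (parTwo V Vmax W hV1 hVmax hW).recordTwo_of_convention_W (parTwo_K_le_Nq V Vmax W hV1 hVmax hW)
    (parTwo_Nq_le V Vmax W hV1 hVmax hW hd) (parTwo_half_le_θ₀ V Vmax W hV1 hVmax hW)
    (parTwo_Amax_le V Vmax W hV1 hVmax hW) (parTwo_one_le_A V Vmax W hV1 hVmax hW) hW' hC0 hCg
  rw [parTwo_A] at h
  exact GenThreeFrameSpecTwo.recordTwo_mono_Vmax hC0 (Nat.le_add_left 1 d) hV1 (by linarith)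
    (parTwo V Vmax W hV1 hVmax hW).hAmax1 (parTwo_Amax_le_Vmax V Vmax W hV1 hVmax hW) h

end ParTwo

end Summit.ABC.StewartYu

end
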